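import Mathlib.MeasureTheory.Function.LocallyIntegrable
import Mathlib.Topology.Order.OrderClosed
import Literature.Barriers.AtomisticToContinuum.NoBVEstimatesMultiD
import HarnessLib

/-!
# Rauch's theorem (`NoBVEstimatesMultiDBarrier`): the printed proof, relative to its two
analytic inputs

Companion to `NoBVEstimatesMultiD.lean` (barrier catalogue
`Literature/Barriers/AtomisticToContinuum/`), which vendors Rauch's Theorem
[Rauch1986, p. 482] as the named fact `NoBVEstimatesMultiDBarrier`: for a quasilinear system (1)
in Rauch's class at `ū`, a small-data `BV` estimate (2) at a time `t̄ > 0` forces the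
commutation relations (3) `[A₀(ū)⁻¹Aⱼ(ū), A₀(ū)⁻¹A_l(ū)] = 0`.

The printed proof [Rauch1986, pp. 482–483] has exactly two analytic inputs, neither of which
is in Mathlib; they are vendored here as named facts, and the theorem is PROVED relative to
them (`NoBVEstimatesMultiDBarrier_of_facts`):

1. `Rauch1986_smallAmplitudeExpansion` — the small-amplitude expansion of the solution with
   data `ū + εφ` [Rauch1986, Local Existence Theorem p. 482 and Proof of Theorem pp. 482–483]:
   "Consider Cauchy data `u_ε(0, ·) = ū + εφ(·)`, `φ ∈ C₀^∞(ℝᵈ)`. Then `u_ε = ū + εv + r_ε`,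
   where `v` is the solution of the linearized equation
   `[A₀(ū)∂ₜ + Σ Aⱼ(ū)∂ⱼ + B′(ū)]v = 0`, `v|_{t=0} = φ` (4), and for any `s > 0`
   `sup_{0 ≤ t ≤ t̄} ‖r_ε(t)‖_{Hˢ} = O(ε²)` ... Using the finite speed of propagation for (1)
   we see that the `r_ε` are supported in a fixed compact subset of `[-t̄, t̄] × ℝᵈ` so"
   `‖∇ₓr_ε(t̄)‖_{L¹} = O(ε²)`; the solutions `u_ε` exist on `[0, t̄]` for `ε` small by the
   Local Existence Theorem (lifespan `c/‖εφ‖_{Hˢ}`), "a result dating from the work of Schauder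
   ... Modern proofs are presented in [4; 5 Chap. 2, 6]" (Lax; Majda 1984, Ch. 2; Taylor).
   Vendored in the weak form the proof consumes: a classical solution `v` of (4) on `[0, T]`
   with `v(0) = φ` and `v(T)` compactly supported, and classical solutions `u_ε` of (1) on
   `[0, T]`, for all small `ε > 0`, with `u_ε(0) = ū + εφ`, `u_ε(T) - ū` compactly supported
   and `∫ |∇ₓu_ε(T) - ε∇ₓv(T)| ≤ C ε²`.
2. `Rauch1986_linearL1EstimateForcesCommutation` — the linear, constant-coefficient step
   "(5) ⟹ (3)" [Rauch1986, Proof of Theorem p. 483]: if the solutions `v` of the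
   constant-coefficient system (4) obey `‖∇ₓv(t̄)‖_{L¹} ≤ c‖∇ₓφ‖_{L¹}` for all `φ ∈ C₀^∞` (5),
   then, via the multiplier `M(ξ) = exp(t̄A₀⁻¹(-Σ A_l iξ_l - B′))`, (6), the `L²` estimate from
   hyperbolicity, interpolation to `Lᵖ`, `1 < p < 2`, and the boundedness of the Riesz
   transforms `Dⱼ/|D|` on `Lᵖ`, `M(D) ∈ Hom(Lᵖ)`, and "we now appeal to the result of Brenner
   [1, 2] which states that (3) is a necessary and sufficient condition for `M` to be an `Lᵖ`
   multiplier for some `1 < p < ∞`, `p ≠ 2`" — Brenner's theorem: [Brenner1973, Thm 5.1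
   p. 93] (differential operators `∂ₜ - P(D)` with `P_d(y)` having imaginary eigenvalues, lower
   order terms allowed: well posed in `Lᵖ`, `p ≠ 2`, and in `L²` iff `P_d(D) = Σ Aⱼ∂ⱼ` with
   commuting diagonable `Aⱼ`), for symmetric systems [BrennerThomeeWahlbin1975, Ch. 5 §1
   Thm 1.1] (= [Brenner1966]). This is Rauch's Theorem for linear constant-coefficient systems.

Then `NoBVEstimatesMultiDBarrier_of_facts` is the remaining, elementary part of the printed
proof: `‖εφ‖_{Hˢ} = ε‖φ‖_{Hˢ} < η` for `ε` small, so (2) applies to `u_ε`: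
`∫|∇u_ε(t̄)| ≤ c∫|ε∇φ|`; with `∫|∇u_ε(t̄) - ε∇v(t̄)| ≤ Cε²` this gives
`ε‖∇v(t̄)‖_{L¹} ≤ cε‖∇φ‖_{L¹} + Cε²`; "dividing by `ε` and letting `ε → 0` yields (5)", and
fact 2 applied to the linearisation (which is in Rauch's class at `0`:
`IsRauchClass.linearization`) gives (3).

## Contents

* `QuasilinearSystem.ofConstant A₀ A B₁` (the constant-coefficient system
  `A₀∂ₜv + Σ Aⱼ∂ⱼv + B₁v = 0`), `QuasilinearSystem.linearization S ū` (Rauch's (4)),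
  `IsRauchClass.linearization`, `hsNormSq_const_smul` (`‖aφ‖²_{Hˢ} = a²‖φ‖²_{Hˢ}`),
  `IsClassicalSolution.contDiff_slice`, `integrable_fderiv_of_hasCompactSupport`.
* the two named facts and `NoBVEstimatesMultiDBarrier_of_facts`.

What is NOT here: proofs of the two facts. Fact 1 needs the `Hˢ` local well-posedness theory
of quasilinear symmetrizable / strictly hyperbolic systems (Kato, Lax, Majda) with `C²`
dependence on the data and finite propagation speed; fact 2 needs uniqueness for the linear
Cauchy problem, the Fourier-multiplier representation of its solution, Riesz transforms,
Riesz–Thorin interpolation and Brenner's theorem. `NoBVEstimatesMultiDBarrier_holds` is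
`NoBVEstimatesMultiDBarrier_of_facts h₁ h₂` once both are discharged.

## References

* [Rauch1986] J. Rauch, *BV estimates fail for most quasilinear hyperbolic systems in
  dimensions greater than one*, Comm. Math. Phys. 106 (1986) 481–484: Local Existence Theorem
  and Theorem (2)–(3) p. 482; Proof of Theorem pp. 482–483, (4)–(6).
* [Brenner1973] P. Brenner, *The Cauchy problem for systems in `Lᵖ` and `L_{p,α}`*, Ark. Mat.
  11 (1973) 75–101: Thm 0.1 p. 76, Thm 5.1 p. 93 (Rauch's [2]).
* [BrennerThomeeWahlbin1975] P. Brenner, V. Thomée, L. Wahlbin, *Besov Spaces and Applications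
  to Difference Methods for Initial Value Problems*, LNM 434 (1975): Ch. 5, §1, Thm 1.1
  pp. 91–92 (the theorem of [Brenner1966] P. Brenner, Math. Scand. 19 (1966) 27–37 = Rauch's
  [1], for symmetric systems).
* [Majda1984] A. Majda, *Compressible Fluid Flow and Systems of Conservation Laws in Several
  Space Variables* (1984), Ch. 2 (Rauch's [5]: local existence, smooth dependence).
-/

noncomputable section

open MeasureTheory Set Filter Topology
open scoped ContDiff

namespace Literature.Barriers.AtomisticToContinuum

open Literature.Analysis.FluidPDE

namespace QuasilinearSystem

variable {d k : ℕ}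

/-! ### Constant-coefficient systems and the linearisation (4) -/

/-- The **constant-coefficient linear system** `A₀∂ₜv + Σⱼ Aⱼ∂ⱼv + B₁v = 0` as a
`QuasilinearSystem` (constant `A₀`, `Aⱼ`; zeroth-order term the linear map `B₁`).
[cite: Rauch1986, (4) p. 482] -/
def ofConstant (A₀ : Matrix (Fin k) (Fin k) ℝ) (A : Fin d → Matrix (Fin k) (Fin k) ℝ)
    (B₁ : (Fin k → ℝ) →L[ℝ] (Fin k → ℝ)) : QuasilinearSystem d k where
  A0 := fun _ => A₀
  A := fun j _ => A j
  B := fun w => B₁ w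
  contDiff_A0 := fun _ _ => contDiff_const
  contDiff_A := fun _ _ _ => contDiff_const
  contDiff_B := B₁.contDiff

/-- Unfolding: the `∂ₜ`-coefficient of `ofConstant A₀ A B₁` is `A₀` at every state.
[cite: Rauch1986, (4) p. 482] -/
@[simp] theorem ofConstant_A0 (A₀ : Matrix (Fin k) (Fin k) ℝ)
    (A : Fin d → Matrix (Fin k) (Fin k) ℝ) (B₁ : (Fin k → ℝ) →L[ℝ] (Fin k → ℝ)) (w : Fin k → ℝ) :
    (ofConstant A₀ A B₁).A0 w = A₀ := rfl

/-- Unfolding: the `∂ⱼ`-coefficient of `ofConstant A₀ A B₁` is `A j` at every state.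
[cite: Rauch1986, (4) p. 482] -/
@[simp] theorem ofConstant_A (A₀ : Matrix (Fin k) (Fin k) ℝ)
    (A : Fin d → Matrix (Fin k) (Fin k) ℝ) (B₁ : (Fin k → ℝ) →L[ℝ] (Fin k → ℝ)) (j : Fin d)
    (w : Fin k → ℝ) : (ofConstant A₀ A B₁).A j w = A j := rfl

/-- Unfolding: the zeroth-order term of `ofConstant A₀ A B₁` is `w ↦ B₁ w`.
[cite: Rauch1986, (4) p. 482] -/
@[simp] theorem ofConstant_B (A₀ : Matrix (Fin k) (Fin k) ℝ)
    (A : Fin d → Matrix (Fin k) (Fin k) ℝ) (B₁ : (Fin k → ℝ) →L[ℝ] (Fin k → ℝ)) (w : Fin k → ℝ) :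
    (ofConstant A₀ A B₁).B w = B₁ w := rfl

/-- For a constant-coefficient system the commutation condition (3) at any state `w` is the
commutation of the `A₀⁻¹Aⱼ`. [cite: Rauch1986, (3) p. 482] -/
theorem jacobiansCommuteAt_ofConstant_iff (A₀ : Matrix (Fin k) (Fin k) ℝ)
    (A : Fin d → Matrix (Fin k) (Fin k) ℝ) (B₁ : (Fin k → ℝ) →L[ℝ] (Fin k → ℝ)) (w : Fin k → ℝ) :
    (ofConstant A₀ A B₁).JacobiansCommuteAt w ↔
      ∀ j l : Fin d, Commute (A₀⁻¹ * A j) (A₀⁻¹ * A l) :=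
  Iff.rfl

/-- **Rauch's linearised system (4) at `ū`**: `A₀(ū)∂ₜv + Σⱼ Aⱼ(ū)∂ⱼv + B′(ū)v = 0`, with
`B′(ū)` the (Fréchet) derivative of `B` at `ū`. [cite: Rauch1986, (4) p. 482] -/
def linearization (S : QuasilinearSystem d k) (ubar : Fin k → ℝ) : QuasilinearSystem d k :=
  ofConstant (S.A0 ubar) (fun j => S.A j ubar) (fderiv ℝ S.B ubar)

/-- The commutation condition (3) of the linearisation at `ū` (at any state) is the commutation
condition (3) of `S` at `ū`. [cite: Rauch1986, (3)–(4) p. 482] -/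
theorem jacobiansCommuteAt_linearization_iff (S : QuasilinearSystem d k) (ubar w : Fin k → ℝ) :
    (S.linearization ubar).JacobiansCommuteAt w ↔ S.JacobiansCommuteAt ubar :=
  Iff.rfl

/-- The linearisation at `ū` of a system in Rauch's class at `ū` is in Rauch's class at `0`
(and at every state): `B′(ū)0 = 0`, and the symmetrizer `Sym(ū)`, resp. strict hyperbolicity
and invertibility of `A₀(ū)`, at the single state `ū` serve at every state of the
constant-coefficient system ("the hyperbolicity of (1) shows that (5) is valid with `L¹`
replaced by `L²`"). [cite: Rauch1986, p. 482 and Proof of Theorem p. 483] -/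
theorem IsRauchClass.linearization {S : QuasilinearSystem d k} {ubar : Fin k → ℝ}
    (h : S.IsRauchClass ubar) : (S.linearization ubar).IsRauchClass 0 where
  B_eq_zero := (fderiv ℝ S.B ubar).map_zero
  hyperbolic := by
    obtain ⟨U, hU, hU'⟩ := h.hyperbolic
    refine ⟨univ, univ_mem, ?_⟩
    rcases hU' with ⟨Sym, -, hSym⟩ | hst
    · exact Or.inl ⟨fun _ => Sym ubar, fun _ _ => contDiff_const,
        fun u _ => hSym ubar (mem_of_mem_nhds hU)⟩
    · exact Or.inr fun u _ => hst ubar (mem_of_mem_nhds hU)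

/-! ### Elementary lemmas used by the assembly -/

/-- `Hˢ`-scaling: `‖aφ‖²_{Hˢ} = a²‖φ‖²_{Hˢ}` for smooth `φ` (`Dⁱ(aφ) = aDⁱφ`). [folklore] -/
theorem hsNormSq_const_smul {s : ℕ} {φ : Space d → Fin k → ℝ} (hφ : ContDiff ℝ ∞ φ) (a : ℝ) :
    hsNormSq s (a • φ) = a ^ 2 * hsNormSq s φ := by
  unfold hsNormSq
  rw [Finset.mul_sum]
  refine Finset.sum_congr rfl fun i _ => ?_
  rw [← integral_const_mul]
  refine integral_congr_ae (Eventually.of_forall fun x => ?_)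
  have hi : ContDiffAt ℝ i φ x := (contDiff_infty.1 hφ i).contDiffAt
  simp only
  rw [iteratedFDeriv_const_smul_apply hi, norm_smul, mul_pow, Real.norm_eq_abs, sq_abs]

/-- `‖φ‖²_{Hˢ} ≥ 0`. [folklore] -/
theorem hsNormSq_nonneg (s : ℕ) (φ : Space d → Fin k → ℝ) : 0 ≤ hsNormSq s φ :=
  Finset.sum_nonneg fun _ _ => integral_nonneg fun _ => sq_nonneg _

/-- A classical solution on `[0, T] × ℝᵈ` has `C¹` time slices `u t`, `t ∈ [0, T]` (compose
with `x ↦ (t, x)`). [folklore] -/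
theorem IsClassicalSolution.contDiff_slice {S : QuasilinearSystem d k} {T : ℝ}
    {u : ℝ → Space d → Fin k → ℝ} (hu : S.IsClassicalSolution T u) {t : ℝ} (ht : t ∈ Icc 0 T) :
    ContDiff ℝ 1 (u t) := by
  have hc : ContDiff ℝ 1 (fun x : Space d => ((t, x) : ℝ × Space d)) :=
    contDiff_const.prodMk contDiff_id
  have := hu.contDiffOn.comp_contDiff hc (fun x => mk_mem_prod ht (mem_univ x))
  simpa [Function.comp_def] using this

/-- A compactly supported `C¹` map has integrable gradient (continuous with compact support).
[folklore] -/
theorem integrable_fderiv_of_hasCompactSupport {f : Space d → Fin k → ℝ} (hf : ContDiff ℝ 1 f)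
    (hc : HasCompactSupport f) : Integrable (fderiv ℝ f) :=
  (hf.continuous_fderiv one_ne_zero).integrable_of_hasCompactSupport (hc.fderiv ℝ)

/-- The gradient of `f` is the gradient of `f - c`, `c` a constant state. [folklore] -/
theorem fderiv_eq_fderiv_sub_const (f : Space d → Fin k → ℝ) (c : Fin k → ℝ) :
    fderiv ℝ f = fderiv ℝ (fun x => f x - c) := by
  funext x
  exact (fderiv_sub_const c).symm

end QuasilinearSystem

open QuasilinearSystem

/-! ### The two analytic inputs of the printed proof (named facts) -/

/-- **Rauch's small-amplitude expansion `u_ε = ū + εv + r_ε`** (named fact, NOT proved here).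
For a system (1) in Rauch's class at `ū` (`IsRauchClass`), a time `T > 0` and
`φ ∈ C₀^∞(ℝᵈ; ℝᵏ)`: there is a classical solution `v` on `[0, T]` of the linearised system (4)
at `ū` (`S.linearization ū`) with `v(0) = φ` and `v(T)` compactly supported (finite speed of
propagation), and there are classical solutions `u_ε` of (1) on `[0, T]`, for all sufficiently
small `ε > 0` (Local Existence Theorem: the solution with data `ū + εφ` exists for
`|t| < c/‖εφ‖_{Hˢ}`), with `u_ε(0) = ū + εφ`, `u_ε(T) - ū` compactly supported (finite speed of
propagation, `B(ū) = 0`), and `∫ ‖∇ₓu_ε(T) - ε∇ₓv(T)‖ dx ≤ C ε²`, i.e.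
`‖∇ₓr_ε(T)‖_{L¹} = O(ε²)` for `r_ε = u_ε - ū - εv` ("for any `s > 0`,
`sup_{0≤t≤t̄} ‖r_ε(t)‖_{Hˢ} = O(ε²)` ... the `r_ε` are supported in a fixed compact subset").
This is the printed statement weakened to what the proof of the Theorem consumes (classical
`C¹` solutions instead of `C^∞`, the remainder bound only at time `T` and in `W^{1,1}`); the
solutions being unique, "there are classical solutions `u_ε`" reads "the solutions `u_ε`".
Its proof needs the `Hˢ` (`s > d/2 + 1`) local well-posedness of quasilinear symmetrizable or
strictly hyperbolic systems with `C²` dependence on the data and finite propagation speed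
(Rauch's refs [3; 4; 5 Chap. 2; 6]), none of which is in Mathlib.
[cite: Rauch1986, Local Existence Theorem p. 482 and Proof of Theorem pp. 482–483] -/
def Rauch1986_smallAmplitudeExpansion : Prop :=
  ∀ ⦃d k : ℕ⦄ (S : QuasilinearSystem d k) (ubar : Fin k → ℝ), S.IsRauchClass ubar →
    ∀ ⦃T : ℝ⦄, 0 < T → ∀ φ : Space d → Fin k → ℝ, ContDiff ℝ ∞ φ → HasCompactSupport φ →
      ∃ v : ℝ → Space d → Fin k → ℝ,
        (S.linearization ubar).IsClassicalSolution T v ∧ (∀ x, v 0 x = φ x) ∧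
        HasCompactSupport (v T) ∧
        ∃ (u : ℝ → ℝ → Space d → Fin k → ℝ) (C : ℝ), ∀ᶠ ε in 𝓝[>] (0 : ℝ),
          S.IsClassicalSolution T (u ε) ∧ (∀ x, u ε 0 x = ubar + ε • φ x) ∧
          HasCompactSupport (fun x => u ε T x - ubar) ∧
          ∫ x, ‖fderiv ℝ (u ε T) x - ε • fderiv ℝ (v T) x‖ ≤ C * ε ^ 2

/-- **Rauch's Theorem for linear constant-coefficient systems: the `L¹` gradient estimate (5)
forces the commutation relations (3)** (named fact, NOT proved here; Rauch's reduction
(5) ⟹ (6) ⟹ `M(D) ∈ Hom(Lᵖ)`, `1 < p < 2`, followed by Brenner's theorem). For a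
constant-coefficient system `A₀∂ₜv + Σⱼ Aⱼ∂ⱼv + B₁v = 0` in Rauch's class at `0`
(symmetrizable: `P A₀` symmetric positive definite and the `P Aⱼ` symmetric for some `P`; or
`A₀` invertible and the system strictly hyperbolic), if there are `c, T > 0` such that for
every `φ ∈ C₀^∞(ℝᵈ; ℝᵏ)` there is a classical solution `v` on `[0, T]` with `v(0) = φ`, `v(T)`
compactly supported and `∫ ‖∇ₓv(T)‖ ≤ c ∫ ‖∇ₓφ‖` (Rauch's (5); classical solutions of the
linear Cauchy problem being unique, "there is a classical solution `v` with ..." reads "the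
solution `v` satisfies ..."), then `[A₀⁻¹Aⱼ, A₀⁻¹A_l] = 0` for all `j, l`. Brenner's theorem
in the generality used (lower-order term `B₁`, non-symmetric hyperbolic principal part): "(5.1)
is well posed in `L_{p,σ}` and in `L₂` if and only if `P_d(D) = Σ Aⱼ∂/∂xⱼ` where
`A₁, …, A_n` are diagonable, commuting matrices with real eigenvalues"
[cite: Brenner1973, Thm 5.1 p. 93 and Thm 0.1 p. 76]; symmetric case, `1 ≤ p ≤ ∞`, `p ≠ 2`:
"well posed in `L_p` if and only if the matrices `A₁, …, A_d` commute"
[cite: BrennerThomeeWahlbin1975, Ch. 5 §1 Thm 1.1 pp. 91–92].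
[cite: Rauch1986, Theorem p. 482 (linear case) and Proof of Theorem p. 483, (5)–(6)] -/
def Rauch1986_linearL1EstimateForcesCommutation : Prop :=
  ∀ ⦃d k : ℕ⦄ (A₀ : Matrix (Fin k) (Fin k) ℝ) (A : Fin d → Matrix (Fin k) (Fin k) ℝ)
    (B₁ : (Fin k → ℝ) →L[ℝ] (Fin k → ℝ)), (ofConstant A₀ A B₁).IsRauchClass 0 →
    ∀ (c T : ℝ), 0 < c → 0 < T →
      (∀ φ : Space d → Fin k → ℝ, ContDiff ℝ ∞ φ → HasCompactSupport φ →
        ∃ v : ℝ → Space d → Fin k → ℝ,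
          (ofConstant A₀ A B₁).IsClassicalSolution T v ∧ (∀ x, v 0 x = φ x) ∧
          HasCompactSupport (v T) ∧
          ∫ x, ‖fderiv ℝ (v T) x‖ ≤ c * ∫ x, ‖fderiv ℝ φ x‖) →
      ∀ j l : Fin d, Commute (A₀⁻¹ * A j) (A₀⁻¹ * A l)

/-! ### The assembly: Rauch's Theorem from the two facts -/

/-- **"Dividing by `ε` and letting `ε → 0` yields (5)"**: the elementary limiting step of the
printed proof. If `u_ε(T)` obeys the `BV` estimate `∫‖∇u_ε(T)‖ ≤ c ε P` for all small
`ε > 0` and `∫‖∇u_ε(T) - ε∇v(T)‖ ≤ Cε²` with all gradients integrable, then `∫‖∇v(T)‖ ≤ cP`.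
[cite: Rauch1986, Proof of Theorem p. 483] -/
theorem integral_norm_le_of_expansion {d k : ℕ} {g : ℝ → Space d → (Space d →L[ℝ] (Fin k → ℝ))}
    {w : Space d → (Space d →L[ℝ] (Fin k → ℝ))} {c P C : ℝ} (hw : Integrable w)
    (h : ∀ᶠ ε in 𝓝[>] (0 : ℝ), Integrable (g ε) ∧ ∫ x, ‖g ε x‖ ≤ c * (ε * P) ∧
      ∫ x, ‖g ε x - ε • w x‖ ≤ C * ε ^ 2) :
    ∫ x, ‖w x‖ ≤ c * P := by
  set J : ℝ := ∫ x, ‖w x‖ with hJ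
  have hpos : ∀ᶠ ε in 𝓝[>] (0 : ℝ), 0 < ε := eventually_mem_nhdsWithin
  have key : ∀ᶠ ε in 𝓝[>] (0 : ℝ), ε * J ≤ c * (ε * P) + C * ε ^ 2 := by
    filter_upwards [h, hpos] with ε ⟨hgi, hBV, hrem⟩ hε
    have hdi : Integrable (fun x => g ε x - ε • w x) := hgi.sub (hw.smul ε)
    have hpt : ∀ x, ε * ‖w x‖ ≤ ‖g ε x‖ + ‖g ε x - ε • w x‖ := fun x => by
      calc ε * ‖w x‖ = ‖g ε x - (g ε x - ε • w x)‖ := by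
            rw [sub_sub_cancel, norm_smul, Real.norm_eq_abs, abs_of_pos hε]
        _ ≤ ‖g ε x‖ + ‖g ε x - ε • w x‖ := norm_sub_le _ _
    have hint : ε * J ≤ (∫ x, ‖g ε x‖) + ∫ x, ‖g ε x - ε • w x‖ := by
      rw [hJ, ← integral_const_mul, ← integral_add hgi.norm hdi.norm]
      exact integral_mono_of_nonneg (Eventually.of_forall fun x => by positivity)
        (hgi.norm.add hdi.norm) (Eventually.of_forall hpt)
    exact hint.trans (add_le_add hBV hrem)
  refine le_of_forall_pos_le_add fun δ hδ => ?_
  have hCε : ∀ᶠ ε in 𝓝[>] (0 : ℝ), C * ε < δ := by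
    have ht : Tendsto (fun ε : ℝ => C * ε) (𝓝[>] 0) (𝓝 0) := by
      have h0 : Tendsto (fun ε : ℝ => C * ε) (𝓝 0) (𝓝 (C * 0)) :=
        tendsto_const_nhds.mul tendsto_id
      rw [mul_zero] at h0
      exact h0.mono_left nhdsWithin_le_nhds
    exact ht.eventually_lt_const hδ
  obtain ⟨ε, hkey, hC, hε⟩ := (key.and (hCε.and hpos)).exists
  have hJle : J ≤ c * P + C * ε := by
    refine le_of_mul_le_mul_left ?_ hε
    calc ε * J ≤ c * (ε * P) + C * ε ^ 2 := hkey
      _ = ε * (c * P + C * ε) := by ring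
  linarith

/-- **Rauch's Theorem relative to its two analytic inputs.** The printed proof
[Rauch1986, pp. 482–483]: given the `BV` estimate (2) with constants `c, t̄, η`, fix
`φ ∈ C₀^∞`; by `Rauch1986_smallAmplitudeExpansion` the solutions `u_ε` with data `ū + εφ`
exist on `[0, t̄]` for small `ε > 0` and `∫|∇u_ε(t̄) - ε∇v(t̄)| = O(ε²)`; since
`‖εφ‖_{Hˢ} = ε‖φ‖_{Hˢ} < η` for small `ε` (`hsNormSq_const_smul`), (2) gives
`∫|∇u_ε(t̄)| ≤ c∫|ε∇φ| = cε∫|∇φ|`, hence `ε‖∇v(t̄)‖_{L¹} ≤ cε‖∇φ‖_{L¹} + O(ε²)`, and dividing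
by `ε`, `ε → 0`: (5) `‖∇v(t̄)‖_{L¹} ≤ c‖∇φ‖_{L¹}` (`integral_norm_le_of_expansion`); the
linearisation is in Rauch's class at `0` (`IsRauchClass.linearization`), so
`Rauch1986_linearL1EstimateForcesCommutation` (with the positive constant `max c 1`) gives
(3). (The Sobolev index `s` enters only through the smallness condition, as in the printed
proof.)
[cite: Rauch1986, Theorem and Proof of Theorem pp. 482–483] -/
theorem NoBVEstimatesMultiDBarrier_of_facts (h₁ : Rauch1986_smallAmplitudeExpansion)
    (h₂ : Rauch1986_linearL1EstimateForcesCommutation) : NoBVEstimatesMultiDBarrier := by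
  intro d k S ubar s hS _hs hBV
  obtain ⟨c, T, η, hT, hη, hest⟩ := hBV
  -- (2) with constant `c` implies (2) with the positive constant `max c 1`
  refine h₂ (S.A0 ubar) (fun j => S.A j ubar) (fderiv ℝ S.B ubar) hS.linearization (max c 1) T
    (lt_max_of_lt_right one_pos) hT ?_
  intro φ hφ hφc
  obtain ⟨v, hv, hv0, hvT, u, C, hev⟩ := h₁ S ubar hS hT φ hφ hφc
  refine ⟨v, hv, hv0, hvT, ?_⟩
  -- `‖εφ‖²_{Hˢ} = ε²‖φ‖²_{Hˢ} < η²` for small `ε`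
  have hsmall : ∀ᶠ ε in 𝓝[>] (0 : ℝ), hsNormSq s (ε • φ) < η ^ 2 := by
    have ht : Tendsto (fun ε : ℝ => ε ^ 2 * hsNormSq s φ) (𝓝 0) (𝓝 0) := by
      have := ((continuous_pow 2).mul continuous_const).tendsto (0 : ℝ)
        (f := fun ε : ℝ => ε ^ 2 * hsNormSq s φ)
      simpa using this
    have h2 : ∀ᶠ ε in 𝓝 (0 : ℝ), ε ^ 2 * hsNormSq s φ < η ^ 2 :=
      ht.eventually_lt_const (by positivity)
    filter_upwards [h2.filter_mono (nhdsWithin_le_nhds (s := Ioi (0 : ℝ)))] with ε hε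
    rwa [hsNormSq_const_smul hφ]
  have hpos : ∀ᶠ ε in 𝓝[>] (0 : ℝ), 0 < ε := eventually_mem_nhdsWithin
  -- the scaled data and its gradient norm
  have hP : ∀ {ε : ℝ}, 0 < ε → ∫ x, ‖fderiv ℝ (ε • φ) x‖ = ε * ∫ x, ‖fderiv ℝ φ x‖ := by
    intro ε hε
    rw [← integral_const_mul]
    refine integral_congr_ae (Eventually.of_forall fun x => ?_)
    have hdx : DifferentiableAt ℝ φ x := (hφ.differentiable (by simp)).differentiableAt
    simp only
    rw [fderiv_const_smul hdx ε, norm_smul, Real.norm_eq_abs, abs_of_pos hε]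
  -- gradient of `v(T)` is integrable
  have hiv : Integrable (fderiv ℝ (v T)) :=
    integrable_fderiv_of_hasCompactSupport (hv.contDiff_slice ⟨hT.le, le_rfl⟩) hvT
  refine integral_norm_le_of_expansion (g := fun ε => fderiv ℝ (u ε T)) (C := C) hiv ?_
  filter_upwards [hev, hsmall, hpos] with ε ⟨hsol, hdata, hsupp, hrem⟩ hεs hε
  refine ⟨?_, ?_, hrem⟩
  · rw [fderiv_eq_fderiv_sub_const (u ε T) ubar]
    exact integrable_fderiv_of_hasCompactSupport
      ((hsol.contDiff_slice ⟨hT.le, le_rfl⟩).sub contDiff_const) hsupp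
  · have hBVε := hest (ε • φ) (hφ.const_smul ε)
      (hφc.mono (Function.support_const_smul_subset ε φ)) hεs (u ε) hsol
      (fun x => by rw [hdata x, Pi.smul_apply])
    rw [hP hε] at hBVε
    exact hBVε.trans (mul_le_mul_of_nonneg_right (le_max_left c 1)
      (mul_nonneg hε.le (integral_nonneg fun _ => norm_nonneg _)))

end Literature.Barriers.AtomisticToContinuum

end
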